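import Literature.AnabelianGeometry.EtaleTheta.Setting
import Literature.AnabelianGeometry.AbsoluteAnabelian.MLFGaloisGroups
import Mathlib.FieldTheory.Galois.Basic
import Mathlib.FieldTheory.IsAlgClosed.AlgebraicClosure
import HarnessLib

/-!
# [EtTh] §2 over §1: "`G_K` is center-free" for the base field of the theta setting, from
# [AbsAnab] Thm. 1.1.1 (ii) (support file of the merge adapter W2-L2-04)

Mochizuki, *The étale theta function …*, Publ. RIMS **45** (2009), proof of Prop. 2.14 (i), PRIMS PDF
p. 50 (printed 276): "since `G_K` is center-free — cf., e.g., [Mzk2], Theorem 1.1.1, (ii)"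
[cite: MochizukiEtTh2009, Prop 2.14 (i) p.50]. Layer L2 of the abc-iut cell, seat abc-iut-L2-t8.

The tree records [AbsAnab] Thm. 1.1.1 (ii) as the named fact
`AbsoluteAnabelian.galoisMLF_slim` ("the absolute Galois group of an MLF is slim"), stated for
Mathlib's `Field.absoluteGaloisGroup K = Gal(K^al/K)`. The theta setting (`Setting.lean`, over the
tree's `SemiGraphs.TemperedCurve p`) sees `G_K` as the subgroup `D.GK = K.fixingSubgroup` of
`G_{ℚ_p} = Gal(ℚ̄_p/ℚ_p)`, `K ⊆ ℚ̄_p` a finite extension of `ℚ_p`. This file TRANSPORTS the fact: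
`ℚ̄_p` is an algebraic closure of `K`, so `K.fixingSubgroup ≅ Gal(ℚ̄_p/K) ≅ Gal(K^al/K)` (Mathlib:
`IntermediateField.fixingSubgroupEquiv`, `IsAlgClosure.equiv`, `AlgEquiv.autCongr`), and a slim group
is center-free. Result: `ThetaSetting.GK_center_free : galoisMLF_slim → ∀ g ∈ D.GK, (g central in
D.GK) → g = 1` — the hypothesis `(hslim)` of the §2 discharge files (seat abc-iut-L2-t10) becomes a
consequence of the named fact. CONDITIONAL on `galoisMLF_slim` (unproved in the tree); nothing
else is asserted.
-/

noncomputable section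

namespace Literature.AnabelianGeometry.EtaleTheta

open Literature.AnabelianGeometry.SemiGraphs
open Literature.AnabelianGeometry.AbsoluteAnabelian (galoisMLF_slim)
open Literature.AlgebraicGeometry.Frobenioids (IsSlimGroup)

namespace ThetaSetting

variable {p : ℕ} [Fact p.Prime] (D : ThetaSetting p)

/-- `ℚ̄_p` is an algebraic closure of the base field `K ⊆ ℚ̄_p` of the theta setting.
[cite: MochizukiEtTh2009, §1 p.11] -/
instance isAlgClosure_K : IsAlgClosure D.K (PadicAlgCl p) where
  isAlgClosed := inferInstance
  isAlgebraic := inferInstance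

/-- **`G_K ≅ Gal(K^al/K)`**: the subgroup `G_K = K.fixingSubgroup ≤ G_{ℚ_p}` of the theta setting is
isomorphic, as a group, to Mathlib's absolute Galois group of `K` (through `Gal(ℚ̄_p/K)` and a
`K`-isomorphism `K^al ≅ ℚ̄_p`). [cite: MochizukiEtTh2009, §1 p.12] -/
def GKEquivAbsoluteGaloisGroup : D.GK ≃* Field.absoluteGaloisGroup D.K :=
  (IntermediateField.fixingSubgroupEquiv D.K).trans
    (AlgEquiv.autCongr (IsAlgClosure.equiv D.K (AlgebraicClosure D.K) (PadicAlgCl p))).symm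

/-- A slim topological group is center-free (the whole group is an open subgroup).
[cite: MochizukiFrdI2008, §0 p.13] -/
theorem eq_one_of_central_of_slim {G : Type*} [Group G] [TopologicalSpace G] (hG : IsSlimGroup G)
    {g : G} (hg : ∀ h : G, h * g = g * h) : g = 1 := by
  have hc := hG.centralizer_eq_bot ⊤ (by rw [Subgroup.coe_top]; exact isOpen_univ)
  have hmem : g ∈ Subgroup.centralizer ((⊤ : Subgroup G) : Set G) := by
    rw [Subgroup.mem_centralizer_iff]
    exact fun h _ => hg h
  rw [hc] at hmem
  exact hmem

/-- **"`G_K` is center-free"** for the theta setting ([AbsAnab] Thm. 1.1.1 (ii), as quoted in the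
proof of [EtTh] Prop. 2.14 (i), p. 50), CONDITIONAL on the tree's named fact `galoisMLF_slim`: an
element of `G_K ≤ G_{ℚ_p}` commuting with all of `G_K` is trivial.
[cite: MochizukiEtTh2009, Prop 2.14 (i) p.50] -/
theorem GK_center_free (hslim : galoisMLF_slim) :
    ∀ g ∈ D.GK, (∀ g' ∈ D.GK, g * g' = g' * g) → g = 1 := by
  intro g hg hcomm
  haveI : FiniteDimensional ℚ_[p] D.K := D.finiteDimensional_K
  have hK : IsSlimGroup (Field.absoluteGaloisGroup D.K) := hslim p D.K
  set Φ := D.GKEquivAbsoluteGaloisGroup with hΦ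
  have hcentral : ∀ τ : Field.absoluteGaloisGroup D.K, τ * Φ ⟨g, hg⟩ = Φ ⟨g, hg⟩ * τ := by
    intro τ
    obtain ⟨x, rfl⟩ := Φ.surjective τ
    rw [← map_mul, ← map_mul]
    congr 1
    apply Subtype.ext
    exact (hcomm x.1 x.2).symm
  have h1 : Φ ⟨g, hg⟩ = 1 := eq_one_of_central_of_slim hK hcentral
  have h2 : (⟨g, hg⟩ : D.GK) = 1 := Φ.injective (by rw [h1, map_one])
  exact congrArg Subtype.val h2

end ThetaSetting

end Literature.AnabelianGeometry.EtaleTheta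

end
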